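import Summits.Ventures.PercRepro.RankLevelSetLevelFiveCqFifteenModulo
import Summits.Ventures.PercRepro.S2CoreFourteen
import Summits.Ventures.PercRepro.S2CellsP14K
import Summits.Ventures.PercRepro.S2CellsP14KB
import Summits.Ventures.PercRepro.S2FourteenNineteen
import Summits.Ventures.PercRepro.S2FourteenTwenty
import Summits.Ventures.PercRepro.S2FourteenTwentyOne
import Summits.Ventures.PercRepro.S2FourteenTwentyTwo
import Summits.Ventures.PercRepro.S2FourteenTwentyThree
import Summits.Ventures.PercRepro.S2FourteenTwentyFour
import Summits.Ventures.PercRepro.S2FourteenTwentyFive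
import Summits.Ventures.PercRepro.S2FourteenTwentySix
import Summits.Ventures.PercRepro.S2FourteenTwentySeven

/-!
# PercRepro — S2: THEOREM C₅ AT `15` MODULO THE SIX CELLS `(14, 6 … 11)` (p7, gen 12; sub-claim S2; the `p = 14` row)

The `p = 14` row at every corank `≥ 12`: `12 … 18` (the concentrated-tail cells, RankLevelSetLevelFiveCqFifteenModulo), `19 … 27` (the same,
the by_cases chain split across declarations), `28 … 42` (the tail-free key cells, S2CellsP14K / S2CellsP14KB) and `≥ 43` (the corank key
`c025_core_five_at_fourteen_big`): **`c025_core_five_fourteen_ge_nineteen`**, and hence **`c025_five_large_sharp15_of_six_cells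
(hsix : the cells (14, 6 … 11)) (M) (p) (hp : 15 ≤ p) : RLS M p 5`** — C-025 at level `5` for every `p ≥ 15` MODULO the six cells
`(14, 6 … 11)`, which are priced OPEN by 0.7–13.5 % (S2 v38 §R3⁗(v)). The window is NOT moved by this file. Axioms: standard.
-/

open scoped Matroid

namespace PercRepro

namespace ThmN

variable {α : Type}

/-- The `p = 14` row at every corank `≥ 19`. -/
theorem c025_core_five_fourteen_ge_nineteen (M : Matroid α) [M.Finite]
    (hR : M.eRank = ((14 : ℕ) : ℕ∞)) (hbig : 14 + 18 < M.E.ncard)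
    (hfree : ∀ e ∈ M.E, ∃ A ⊆ M.E \ {e}, e ∉ M.closure A ∧ e ∉ M.closure ((M.E \ {e}) \ A)) : RLS M 14 5 := by
  rcases Nat.lt_or_ge M.E.ncard (14 + 43) with h | h
  · have hn : M.E.ncard = 14 + (M.E.ncard - 14) := by omega
    have h19 : 19 ≤ M.E.ncard - 14 := by omega
    have h42 : M.E.ncard - 14 ≤ 42 := by omega
    generalize M.E.ncard - 14 = d at hn h19 h42
    interval_cases d
    · exact c025_core_five_fourteen_nineteen M hR hn hfree
    · exact c025_core_five_fourteen_twenty M hR hn hfree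
    · exact c025_core_five_fourteen_twentyone M hR hn hfree
    · exact c025_core_five_fourteen_twentytwo M hR hn hfree
    · exact c025_core_five_fourteen_twentythree M hR hn hfree
    · exact c025_core_five_fourteen_twentyfour M hR hn hfree
    · exact c025_core_five_fourteen_twentyfive M hR hn hfree
    · exact c025_core_five_fourteen_twentysix M hR hn hfree
    · exact c025_core_five_fourteen_twentyseven M hR hn hfree
    · exact c025_fourteen_28 M hR hn hfree
    · exact c025_fourteen_29 M hR hn hfree
    · exact c025_fourteen_30 M hR hn hfree
    · exact c025_fourteen_31 M hR hn hfree
    · exact c025_fourteen_32 M hR hn hfree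
    · exact c025_fourteen_33 M hR hn hfree
    · exact c025_fourteen_34 M hR hn hfree
    · exact c025_fourteen_35 M hR hn hfree
    · exact c025_fourteen_36 M hR hn hfree
    · exact c025_fourteen_37 M hR hn hfree
    · exact c025_fourteen_38 M hR hn hfree
    · exact c025_fourteen_39 M hR hn hfree
    · exact c025_fourteen_40 M hR hn hfree
    · exact c025_fourteen_41 M hR hn hfree
    · exact c025_fourteen_42 M hR hn hfree
  · exact c025_core_five_at_fourteen_big M (by omega) hfree

/-- **THEOREM C₅ AT `15` MODULO THE SIX CELLS** `(14, 6 … 11)`. -/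
theorem c025_five_large_sharp15_of_six_cells
    (hsix : ∀ (M : Matroid α) [M.Finite] (d : ℕ), 6 ≤ d → d ≤ 11 → M.eRank = ((14 : ℕ) : ℕ∞) →
      M.E.ncard = 14 + d →
      (∀ e ∈ M.E, ∃ A ⊆ M.E \ {e}, e ∉ M.closure A ∧ e ∉ M.closure ((M.E \ {e}) \ A)) → RLS M 14 5)
    (M : Matroid α) [M.Finite] (p : ℕ) (hp : 15 ≤ p) : RLS M p 5 := by
  refine c025_five_large_sharp15_of_cells ?_ M p hp
  intro M _ d hd6 hor hR hn hfree
  rcases hor with h11 | h19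
  · exact hsix M d hd6 h11 hR hn hfree
  · exact c025_core_five_fourteen_ge_nineteen M hR (by omega) hfree

end ThmN

end PercRepro
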